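import Mathlib
import HarnessLib

/-!
# Window-deficit correctors: bounded-below window sums make a sequence a coboundary plus a nonnegative part

Topic `Literature/Dynamics/Ergodic` (ergodic optimisation / sub-actions; Mathlib has `birkhoffSum` but no
coboundary–sub-action statements).  The elementary one-sided half of the Gottschalk–Hedlund circle of
ideas, for a single real sequence on `ℤ`: if every window sum of `f` is at least `−C`,
`∑_{k=m}^{n} f k ≥ −C` for all `m ≤ n`, then the "Mañé potential from the left"
`u n := ⨅_{j ≤ n} ∑_{k=j}^{n} f k` is a CORRECTOR: `−C ≤ u n ≤ f n` and `u n ≤ u (n−1) + f n`, i.e.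
`f n = (u n − u (n−1)) + g n` with `g ≥ 0` and `u` bounded below by `−C` (and above by `f`).
In ergodic-optimisation language `u` is a (one-sided, trivial-dynamics) sub-action; the statement is what turns a
uniform lower bound on all finite-window averages ("every periodisation has average `≥ e`") into a POINTWISE
inequality up to a bounded transfer between neighbours — the form in which layer-by-layer energy floors are
consumed by sitewise certificates (crux `NashNearField`, stmt-AtomisticToContinuum-16827; the Hägg cushion
bookkeeping of crux `NearFieldConvexity`, stmt-13958).

* `windowCorrector f n = ⨅ j : {j // j ≤ n}, ∑ k ∈ Icc j n, f k`;
* `neg_le_windowCorrector`, `windowCorrector_le`, `windowCorrector_le_pred_add` — the three corrector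
  inequalities under the window hypothesis;
* `exists_corrector_of_window_sum_ge` — packaged: `∃ u g, (∀ n, −C ≤ u n ∧ u n ≤ f n) ∧ (∀ n, 0 ≤ g n) ∧
  ∀ n, f n = u n − u (n − 1) + g n`.

References: W. H. Gottschalk, G. A. Hedlund, *Topological Dynamics* (1955), Thm 14.11 (bounded cocycles are
coboundaries; the two-sided continuous statement, not needed here); E. Garibaldi, *Ergodic Optimization in the
Expanding Case* (2017), Ch. 3 (sub-actions, Mañé potential).  The sequence statement itself is [folklore].
-/

noncomputable section

open Finset

namespace Literature.Dynamics.Ergodic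

variable (f : ℤ → ℝ)

/-- The **left Mañé potential / window corrector** of a real sequence on `ℤ`:
`u n = ⨅_{j ≤ n} ∑_{k=j}^{n} f k` (a conditionally complete infimum; meaningful when the window sums ending
at `n` are bounded below, junk otherwise). [folklore] -/
def windowCorrector (n : ℤ) : ℝ :=
  ⨅ j : {j : ℤ // j ≤ n}, ∑ k ∈ Icc (j : ℤ) n, f k

variable {f} {C : ℝ}

/-- The window sums ending at `n` are bounded below under the window hypothesis. [folklore] -/
theorem bddBelow_windowSums (hwin : ∀ m n : ℤ, m ≤ n → -C ≤ ∑ k ∈ Icc m n, f k) (n : ℤ) :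
    BddBelow (Set.range fun j : {j : ℤ // j ≤ n} => ∑ k ∈ Icc (j : ℤ) n, f k) := by
  refine ⟨-C, ?_⟩
  rintro _ ⟨j, rfl⟩
  exact hwin j n j.2

/-- Lower bound: `−C ≤ u n`. [folklore] -/
theorem neg_le_windowCorrector (hwin : ∀ m n : ℤ, m ≤ n → -C ≤ ∑ k ∈ Icc m n, f k) (n : ℤ) :
    -C ≤ windowCorrector f n := by
  haveI : Nonempty {j : ℤ // j ≤ n} := ⟨⟨n, le_rfl⟩⟩
  exact le_ciInf fun j => hwin j n j.2

/-- Upper bound: `u n ≤ f n` (the one-term window). [folklore] -/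
theorem windowCorrector_le (hwin : ∀ m n : ℤ, m ≤ n → -C ≤ ∑ k ∈ Icc m n, f k) (n : ℤ) :
    windowCorrector f n ≤ f n := by
  have h := ciInf_le (bddBelow_windowSums hwin n) ⟨n, le_rfl⟩
  simpa [windowCorrector] using h

/-- The corrector inequality: `u n ≤ u (n − 1) + f n` (every window ending at `n − 1` extends by the term
`f n` to a window ending at `n`). [folklore] -/
theorem windowCorrector_le_pred_add (hwin : ∀ m n : ℤ, m ≤ n → -C ≤ ∑ k ∈ Icc m n, f k) (n : ℤ) :
    windowCorrector f n ≤ windowCorrector f (n - 1) + f n := by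
  haveI : Nonempty {j : ℤ // j ≤ n - 1} := ⟨⟨n - 1, le_rfl⟩⟩
  suffices h : windowCorrector f n - f n ≤ windowCorrector f (n - 1) by linarith
  refine le_ciInf fun j => ?_
  have hjn : (j : ℤ) ≤ n := j.2.trans (by linarith)
  have hsplit : ∑ k ∈ Icc (j : ℤ) n, f k = f n + ∑ k ∈ Icc (j : ℤ) (n - 1), f k := by
    rw [← insert_Icc_sub_one_right_eq_Icc hjn, sum_insert]
    simp
  have h := ciInf_le (bddBelow_windowSums hwin n) ⟨j, hjn⟩
  simp only at h
  rw [hsplit] at h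
  show windowCorrector f n - f n ≤ ∑ k ∈ Icc (j : ℤ) (n - 1), f k
  unfold windowCorrector
  linarith

/-- **Bounded-below window sums ⇒ coboundary plus nonnegative part.**  If `∑_{k=m}^{n} f k ≥ −C` for all
`m ≤ n`, then `f n = u n − u (n − 1) + g n` with `g ≥ 0` and `−C ≤ u n ≤ f n` for all `n`
(`u = windowCorrector f`).  In particular, if also `f ≤ B` pointwise then `|u| ≤ max C |B|`: a uniformly
bounded nearest-neighbour transfer `u` makes `f` pointwise nonnegative. [folklore] -/
theorem exists_corrector_of_window_sum_ge (hwin : ∀ m n : ℤ, m ≤ n → -C ≤ ∑ k ∈ Icc m n, f k) :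
    ∃ u g : ℤ → ℝ, (∀ n, -C ≤ u n ∧ u n ≤ f n) ∧ (∀ n, 0 ≤ g n) ∧ ∀ n, f n = u n - u (n - 1) + g n := by
  refine ⟨windowCorrector f, fun n => f n - (windowCorrector f n - windowCorrector f (n - 1)),
    fun n => ⟨neg_le_windowCorrector hwin n, windowCorrector_le hwin n⟩, fun n => ?_, fun n => by ring⟩
  have h := windowCorrector_le_pred_add hwin n
  linarith

end Literature.Dynamics.Ergodic

end
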